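import Literature.NumberTheory.EllipticCurves.GlobalMinimalModelProofs
import Literature.NumberTheory.EllipticCurves.IsogenyVariableChangeProofs
import HarnessLib

/-!
# Transport of the `ℓ`-torsion Galois module to a global minimal model

Helper (`--supports`) for the crux `Summit.ABC.ABC.Theses.IsogenyGlueCongruence.PolyFreyMazurPairs`
(stmt-ABC-2047), line `sturm-window-effective-smo`, stub `stub_torsionTransportMinimal`.

**Statement (`stub_torsionTransportMinimal`).** For every elliptic curve `W/ℚ` (any Weierstrass
equation) and every prime `ℓ` there is an admissible change of variables `C` over `ℚ` such that
`C • W` is a globally minimal Weierstrass equation, together with a `Γ_ℚ`-equivariant group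
isomorphism `W[ℓ] ≃+ (C • W)[ℓ]` of the geometric `ℓ`-torsion.

**Proof.** Néron / Silverman *AEC* VIII.8 Cor. 8.3 (`ℤ` is a PID): a global minimal model `C • W`
exists (`WeierstrassCurve.hasGlobalMinimalModel_rat_holds`, proved in the tree). The change of
variables `(x, y) ↦ (u⁻²(x − r), u⁻³(y − s(x − r) − t))` has coefficients in `ℚ`, so the induced
isomorphism of `ℚ̄`-points `VariableChange.pointEquivBaseChange W C ℚ̄ : W(ℚ̄) ≃+ (C • W)(ℚ̄)`
(the homomorphism underlying the isogeny `VariableChange.toIsogeny W C`, Silverman *AEC*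
III.3.1(b)) commutes with `Gal(ℚ̄/ℚ)` (`Isogeny.equivariant`); being additive and bijective it
maps `W[n]` onto `(C • W)[n]` for every `n : ℤ`, and the restriction is the required equivariant
isomorphism (no primality or ellipticity is needed for this half).

Adapted from `hasIrreducibleModPGaloisRep_smul_iff`
(`Literature/NumberTheory/EllipticCurves/OpenImageMazurAssemblyProofs.lean`) and the transport
lemma `exists_equivariant_addEquiv_of_isogeny` of `Cruxes/PolyFreyMazurPairs/Disproof.lean`.
-/

-- `Summit.ABC.ABC` is the mandated summit-side namespace (CONVENTIONS §2); the duplicate is deliberate.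
set_option linter.dupNamespace false

open scoped Classical

namespace Summit.ABC.ABC.Theorems.PolyFreyMazurPairs

open WeierstrassCurve Literature.NumberTheory.EllipticCurves

/-- **`W[n] ≃ (C • W)[n]`, `Γ_ℚ`-equivariantly.** The isomorphism of geometric points of a change
of Weierstrass equation `C` over `ℚ` (`VariableChange.pointEquivBaseChange`, the map underlying
`VariableChange.toIsogeny W C`; Silverman *AEC* III.3.1(b)) is additive, bijective and
`Γ_ℚ`-equivariant, hence restricts to a `Γ_ℚ`-equivariant isomorphism of the `n`-torsion
subgroups, for every `n : ℤ`. [cite: SilvermanAEC2009, III.3.1(b) and III.7] -/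
theorem exists_equivariant_addEquiv_geomTorsion_smul (W : WeierstrassCurve ℚ)
    (C : VariableChange ℚ) (n : ℤ) :
    ∃ e : W.geomTorsion n ≃+ (C • W).geomTorsion n,
      ∀ (σ : Field.absoluteGaloisGroup ℚ) (P : W.geomTorsion n), e (σ • P) = σ • e P := by
  -- adapted from Literature/NumberTheory/EllipticCurves/OpenImageMazurAssemblyProofs.lean
  -- (`hasIrreducibleModPGaloisRep_smul_iff`) and Cruxes/PolyFreyMazurPairs/Disproof.lean
  -- (`exists_equivariant_addEquiv_of_isogeny`)
  let e : W.geomPoints ≃+ (C • W).geomPoints :=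
    VariableChange.pointEquivBaseChange W C (AlgebraicClosure ℚ)
  have hsmul : ∀ (σ : Field.absoluteGaloisGroup ℚ) (P : W.geomPoints), e (σ • P) = σ • e P :=
    fun σ P => (VariableChange.toIsogeny W C).equivariant σ P
  have htor : ∀ {P : W.geomPoints}, P ∈ W.geomTorsion n ↔ e P ∈ (C • W).geomTorsion n := by
    intro P
    refine (Submodule.mem_torsionBy_iff n P).trans
      (Iff.trans ?_ (Submodule.mem_torsionBy_iff n (e P)).symm)
    rw [← map_zsmul e n P, AddEquiv.map_eq_zero_iff]
  let eₙ : W.geomTorsion n ≃+ (C • W).geomTorsion n :=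
    { toFun := fun P => ⟨e P, htor.mp P.2⟩
      invFun := fun Q => ⟨e.symm Q, by rw [htor, e.apply_symm_apply]; exact Q.2⟩
      left_inv := fun P => Subtype.ext (e.symm_apply_apply _)
      right_inv := fun Q => Subtype.ext (e.apply_symm_apply _)
      map_add' := fun P Q => Subtype.ext (by
        change e ((P : W.geomPoints) + Q) = e P + e Q
        exact map_add e _ _) }
  refine ⟨eₙ, fun σ P => Subtype.ext ?_⟩
  change e ((σ • P : W.geomTorsion n) : W.geomPoints) = σ • e (P : W.geomPoints)
  rw [Literature.NumberTheory.EllipticCurves.AddSubgroup.torsionBy.coe_smul, hsmul]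

/-- **Transport of the torsion module to a global minimal model** (stub
`stub_torsionTransportMinimal` of line `sturm-window-effective-smo`). Every elliptic `W/ℚ` has a
global minimal model `C • W` (Néron 1964; Silverman *AEC* VIII.8 Cor. 8.3, the tree's
`WeierstrassCurve.hasGlobalMinimalModel_rat_holds`), and the change of variables, having
coefficients in `ℚ`, is a `Γ_ℚ`-equivariant isomorphism of geometric points (Silverman *AEC*
III.3.1(b)), hence restricts to a `Γ_ℚ`-equivariant group isomorphism `W[ℓ] ≃+ (C • W)[ℓ]`
(`exists_equivariant_addEquiv_geomTorsion_smul`).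
[cite: SilvermanAEC2009, VIII.8 Cor. 8.3 and III.3.1(b)] -/
theorem stub_torsionTransportMinimal :
    ∀ (W : WeierstrassCurve ℚ) [W.IsElliptic] (ℓ : ℕ), ℓ.Prime →
      ∃ C : WeierstrassCurve.VariableChange ℚ, (C • W).IsGloballyMinimal ∧
        ∃ e : W.geomTorsion ℓ ≃+ (C • W).geomTorsion ℓ,
          ∀ (σ : Field.absoluteGaloisGroup ℚ) (P : W.geomTorsion ℓ), e (σ • P) = σ • e P := by
  intro W _ ℓ _
  obtain ⟨C, hC⟩ := hasGlobalMinimalModel_rat_holds W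
  exact ⟨C, hC, exists_equivariant_addEquiv_geomTorsion_smul W C ℓ⟩

end Summit.ABC.ABC.Theorems.PolyFreyMazurPairs
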